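/-
Copyright: statement-level skeleton of a published paper (lit-balaban cell, Phase-2 proof seat p26 gen 40). No claims beyond
what the kernel checks below.
-/
import Mathlib
import Literature.MathematicalPhysics.QuantumFieldTheory.Balaban1983to89.B3GraphAmplitude
import Literature.MathematicalPhysics.QuantumFieldTheory.Balaban1983to89.B3Eq18VertexExpansion
import Literature.MathematicalPhysics.QuantumFieldTheory.Balaban1983to89.B3Eq114AveragingVertices

/-!
# B3 — T. Bałaban, *(Higgs)₂,₃ quantum fields in a finite volume. III. Renormalization*, CMP **88** (1983) 411–445
[Balaban1983Higgs3] — pp. 413–415, 420 [PDF 3–5, 10]: **the Feynman rules of the catalogue (1.6)–(1.15) as POLARIZED vertex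
functionals on the concrete (Higgs)₂,₃ carriers, their diagonals = the typer's vertices `vertex16 … vertex115`, and the assembled
expression E(G, {□(v)}_{v∈G}, Φ_ext, A_ext) WITH BODY for p18's graphs `B3Cor23Concrete.Graph`** (FILE 2 of the evaluator; FILE 1 =
`B3GraphAmplitude`: the index-form evaluator `amp` with the rules as parameters), with the three printed LOCALIZATION prescriptions of
p. 420 (unit cubes · a smooth partition of unity per vector leg · block points) as partition families and the localization sum
E(G) = Σ_{{□(v)}} E(G, {□(v)}) PROVED for the concrete rules

statement-level skeleton of published theorems with citation tags; proofs where landed; nothing here is a claim about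
the Yang–Mills mass gap

PDF held: `paper:balaban1983-higgs-2-3-quantum-fields-finite-volume` (journal page = PDF page + 410); pp. 413–415, 420 read by this
seat on the ×2 renders `run/shared/lean/pub/pub-balaban/b2b-balaban-ref1/pages/1983-cmp88-higgs23-III/…-p003,p004,p005,p010-x2.png`
(2026-08-23); the displays (1.6)–(1.15) are taken from the typer's verified transcriptions in `B3Eq18VertexExpansion` /
`B3Eq114AveragingVertices` (same renders), not from the OCR layer.

CITATION HEADER (lean-in-tree rule).  lit-balaban TYPED SKELETON (HOME `run/shared/lean/pub/lit-balaban/`), PHASE 2, seat p26 gen 40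
(unit `lit-balaban-p26`); OWNER-NAMED target (fold owner r15 g15, HOME/INBOX 2026-08-23T09:39Z HEAD QUESTION 26 on row **B3.Def@420**,
and the owner's word to this seat 09:56Z: *"please TAKE it … keep the amplitude's INPUT kernels (propagators G_k(Ω,B̃), G_k, the
(1.13)–(1.15) operator legs) as supplied kernel parameters with the tree's names"*; the lead's ruling on Q26 (10:04Z): B3.Def@420
`proved` under reading (P′) with the clause *"general evaluator not built — identification owed at B3.Prop1"* — FILE 1 + this file
build it); design note `HOME/lit-balaban-p26/DESIGN-B3-evaluator.md`.  ROWS **B3.Def@420** (p. 420), **B3.Eq1.6-1.11**, **B3.Eq1.12-1.15**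
(the catalogue; heads `typed`/located members = the typer's files), **B3.Prop1** (where E is consumed) of `HOME/lit-balaban-r15/ROWS-B3.md`
(cells only; heads are the owner's / the lead's call).  CONSUMES BY NAME, nothing re-declared: the typer's vertices
`B3Eq18VertexExpansion.vertex16/vertex17/leg18/leg110/remTensor/vertex18/vertex19/vertex110/vertex111` (p357995 lineage) and
`B3Eq114AveragingVertices.vertex113/vertex114/vertex115` (p35x lineage), the carriers `HiggsLattice.Site/PBond/ScalarField/VecField/
ChargeData/covDeriv`, `HiggsAveraging.blockK/blockIter`, `HiggsCovariance.kernel` (how `propagatorK` enters), r15's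
`B3VertexTensorBounds.taylorRemOp` and `B3Prop1.VertexKind`, p18's `B3Cor23Concrete.Graph`, FILE 1's `Rules/outSlots/amp/basisV/
amp_rules_sum/amp_sLines_sum`.

THE PRINTED TEXT (verbatim).  p. 413 [PDF 3], after (1.6): *"φ′(x) is a scalar field leg"*; p. 414 [PDF 4], lines 36–46 (×2 render
p004; v1.1: the v1.0 header paraphrased the second sentence — referee ref-4 D-g68-2): *"All the A′-legs are contracted, i.e. they are
divided into pairs and each pair is replaced by the corresponding propagator. Some φ′-legs are replaced by external scalar fields and
the remaining are again divided into pairs and each pair is replaced by a propagator, i.e. by G_k(Ω,B̃), G_k(Ω₂,B̃), δG_k(Ω,Ω₂,B̃) or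
the operator (1.16)."*; p. 415 [PDF 5], (1.17): *"an external scalar field, or a leg in a vertex … an external
vector field, or a leg in a vertex … the operator (1.13) acting on a scalar field leg"*, (1.18): *"They are obtained by taking a scalar
product of two expressions from (1.12)–(1.15) and multiplying it by −a_k, or −½a_k if they are equal."*, *"The above notations in
(1.17) and (1.18) are not precise, but they can be made quite precise if we specify a number and nature of legs."*; p. 414: *"and
finally we sum over y ∈ T₁^{(k)} ∩ Ω"*; p. 420 [PDF 10]: *"The next thing we need is a further localization in the vertices. For the
vertices (1.6) and (1.7) we localize simply by representing Ω₁ as a sum of unit cubes of the η-lattice. For the remaining vertices we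
localize, taking for each leg of the vector field a smooth partition of unity satisfying the condition that a support of each
function is contained in a cube with sides of length 2. We perform this localization for the terms of δm²_k(…), E_k(…) also. The
expressions (1.12)–(1.15) are localized by fixing a point y ∈ T₁^{(k)}∩Ω, or the unit cube B^k(y). Thus with each expression there is
connected some localization {□(v)}_{v∈G} … Let us denote by E(G, {□(v)}_{v∈G}, Φ_ext, A_ext) the expression corresponding to graph
G with localizations {□(v)}_{v∈G} and external fields Φ_ext, A_ext."*  The displays (1.6)–(1.15): see the headers of
`B3Eq18VertexExpansion` and `B3Eq114AveragingVertices`.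

READING (declared).  *"a leg in a vertex"* (1.17) = an argument slot of a multilinear functional: the POLARIZED vertex has one field
per leg — (1.6) `|φ′(x)|⁴ = (φ′·φ′)(φ′·φ′) ↦ (f₀·f₁)(f₂·f₃)`, (1.7) `|φ′|² ↦ f₀·f₁`, (1.8)/(1.9) `[(D^η_B̃φ′)(b)·Tφ′(b₋)] ↦
[(D^η_B̃f₀)(b)·Tf₁(b₋)]`, (1.10)/(1.11) `[φ′(b₋)·Tφ′(b₋)] ↦ [f₀(b₋)·Tf₁(b₋)]`, the A′-legs `(g_kA′_b)^n ↦ Π_{j<n}(g_ka_j)_b`, in (1.14)/(1.15)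
`(A′(Γ^{(k)}_{y,x}))^n ↦ Π_j a_j(Γ^{(k)}_{y,x})` through a supplied contour functional `ctr` (the tree's `HiggsAveraging.multiContourSum`,
resp. `B3Eq15ChargeDerivative.etaSumK`/`Data14.fluctContour` in the multiscale reading (1.3)) — legs are LABELLED (print: *"specify a
number and nature of legs"*), no symmetrization; the small field `Ã`, the background `B̃`, the cut-off `g_k`, the couplings stay
inside the rule (they are not legs of p18's `Graph`, whose legs are `scalarLegs ⊕ vectorLegs`).  On the DIAGONAL (every leg the same
field, trivial localization) each polarized rule IS the typer's vertex (`rule16_diag` … `rule111_diag`, `avg114_diag`, `avg115_diag`).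
The averaging expressions (1.13)–(1.15) are `W`-valued functions of the block point `y ∈ T₁^{(k)}`: their rule carries the position sum
*"finally we sum over y"* like every other vertex and reads the output against a level-`k` co-field (FILE 1's output slot, `OF` =
`ScalarField P k N`, indices `T₁^{(k)} × Fin N`), so that the (1.18) pairing kernel `−κ[y = y′]δ_{ab}` (`pairKernel`) and the product with
the external field (1.12) (`extO`) put both factors at the same `y`.  LOCALIZATION (p. 420) = a weight on the vertex's position species
(`Loc`: sites / bonds / block points; `speciesOf`): the indicator of a unit cube `B^k(y)` for (1.6), (1.7) (`Loc.cube`); for a vertex with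
`n` vector legs at the bond `b` the product `Π_{j<n} χ_{c_j}(b₋)` of one partition member per vector leg (`Loc.legProd`; the smooth
partition `χ` with supports in side-2 cubes is p33's `B3SmoothLocalization420.chi`, `sum_chi`, entering through the hypothesis
`Σ_c χ_c = 1`); the point mass at `y` for (1.13)–(1.15) (`Loc.point`).

WHAT IS TYPED / PROVED (definitions with bodies + theorems; no `Prop` fact, no `sorry`; standard axioms).  §1 `rule16`, `rule17`,
`pleg18`, `pleg110`, `vlegs`, `rule18`, `rule19`, `rule110`, `rule111` (polarized (1.6)–(1.11) at any level, with a localization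
weight), **`rule16_diag` … `rule111_diag`** (diagonal = the typer's `vertex16 … vertex111`), `rule16_sum` … `rule111_sum` (linear in the
weight); §2 `rule113`, `avg114`/`rule114`, `avg115`/`rule115` (polarized (1.13)–(1.15) with level-`k` output fields), `rule113_point`,
**`avg114_diag`/`rule114_point`**, **`avg115_diag`/`rule115_point`** (at the point `y`, on the diagonal = the output co-field paired with the
typer's `vertex113/114/115`), `rule113_sum` … ; §3 `Model` (the step-`k` model data), `Loc`/`Loc.triv`/`Loc.sum`, `Species`/`speciesOf`,
`Loc.AgreeFor`, `Loc.IsPartitionFor`, `Loc.cube`/`Loc.legProd`/`Loc.point` with **`isPartitionFor_cube`/`isPartitionFor_legProd`/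
`isPartitionFor_point`** (the three printed prescriptions ARE partitions), **`ruleOfKind`** (the rule of each `VertexKind` as an
inhabitant of FILE 1's `Rules` slot type — `scalarLegs κ` φ′-legs, `vectorLegs κ` A′-legs, `outSlots κ` outputs, by dependent pattern
matching; it computes: `rulesOf g36a … = rule18 … 1 0 …` holds by `rfl`, scratch), `ruleOfKind_sum`, `ruleOfKind_congr`,
**`ruleOfKind_partition`**, `ruleOfKind_v16_diag … _v111_diag`, `ruleOfKind_v113_point … _v115_point`, `rulesOf`, `basisE` (`δ_x ⊗ e_a`) + `basisE_apply` + `inner_basisE` + **`sum_coord_smul_basisE`** (φ = Σ φ(x)_a·(δ_x ⊗ e_a)),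
`opEntry` + `opEntry_eq_kernel` (how an operator on fields — `HiggsCovariance.propagatorK`, its (2.6) pieces — becomes a line kernel:
the entries of `HiggsCovariance.kernel`), `bondEntry` (the same for the vector propagator `HiggsFluctMeasure.vecG` on bonds), `extS`, `extO`, `pairKernel` + **`sum_pairKernel`** (it realizes (1.18): `−κ Σ_y T(y)·T′(y)`), **`graphAmp`** = E(G, {□(v)}, Φ_ext, A_ext) for p18's `G` and the
model data (FILE 1's `amp` at `rulesOf`, coordinate bases), THEOREMS **`graphAmp_loc_sum`** and **`graphAmp_partition_sum`** (p. 420 on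
the concrete evaluator: for partition families at every vertex, Σ_{c : v ↦ □(v)} E(G, {□(v)}) = E(G)), `graphAmp_sLines_sum` /
`graphAmp_vLines_sum` ((2.7) p. 425 for the concrete evaluator).
HONEST SCOPE.  (a) Print displays no general Feynman rules; the polarization is OUR reading of *"a leg in a vertex"*, fixed so that
the diagonal is the printed vertex (proved) — the *"proper combinatorial factor"* (p. 414) and the coefficients of the classes G_ren
are not part of E(G) and are not modelled.  (b) Graphs of the step-`k` expansion: fine fields on `T_η` (level `0` of the tree's
`HiggsLattice`, mesh `P.mesh 0`), averaging vertices at the block level `k`; averaging vertices of EARLIER steps inside a graph (their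
outputs already paired at their step) are outside this typing, as in FILE 1 (d).  (c) Kernels are parameters (owner's precision): the
scalar lines take `opEntry (propagatorK …)` or its (2.6) pieces, the vector lines `bondEntry (vecG …)`, the output
pairs `pairKernel κ`; nothing about these operators (existence of inverses, bounds) is used or claimed.  (d) The contour functional
`ctr`, the contour values `β = B̃(Γ^{(k)}_{y,·})`, `τ = Ã(Γ^{(k)}_{y,·})` and the averaging weight are fields of `Model`, to be filled
with the tree's `multiContourSum`/`etaSumK`/`fluctContour` by the instantiating seat; no property of them is used.  (e) No estimate,
no convergence statement, nothing on (1.33): this file gives E a BODY; the identification with the abstract carrier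
`B3Prop1.Expansion.E` (a typed parameter) is by instantiation at the consumer.  Unit `lit-balaban-p26` gen 40
(literature-prover-lit-balaban-p26-g40-0), HOME `run/shared/lean/pub/lit-balaban/`, 2026-08-23.
-/

open scoped BigOperators InnerProductSpace
open Finset

namespace Literature.MathematicalPhysics.QuantumFieldTheory.Balaban1983to89.B3GraphAmplitudeRules

open Literature.MathematicalPhysics.QuantumFieldTheory.Balaban1983to89.HiggsLattice (ChargeData covDeriv)
open Literature.MathematicalPhysics.QuantumFieldTheory.Balaban1983to89.HiggsCovariance (E kernel)
open Literature.MathematicalPhysics.QuantumFieldTheory.Balaban1983to89.HiggsAveraging (blockK blockIter)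
open Literature.MathematicalPhysics.QuantumFieldTheory.Balaban1983to89.B3VertexTensorBounds (taylorRemOp)
open Literature.MathematicalPhysics.QuantumFieldTheory.Balaban1983to89.B3Eq18VertexExpansion
  (Op vertex16 vertex17 leg18 leg110 remTensor vertex18 vertex19 vertex110 vertex111)
open Literature.MathematicalPhysics.QuantumFieldTheory.Balaban1983to89.B3Eq114AveragingVertices
  (vertex113 vertex114 vertex115)
open Literature.MathematicalPhysics.QuantumFieldTheory.Balaban1983to89.B3Prop1 (VertexKind)
open Literature.MathematicalPhysics.QuantumFieldTheory.Balaban1983to89.B3Cor23Concrete (Graph)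
open Literature.MathematicalPhysics.QuantumFieldTheory.Balaban1983to89.B3GraphAmplitude

noncomputable section

variable {P : HiggsLattice.Params} {N k : ℕ}

/-! ## §0 Weighted position sums (bookkeeping) -/

/-- kernel: a family of weighted sums, summed over the family, is the weighted sum for the summed weight. [folklore] -/
private theorem sum_wsum {X ι : Type*} [Fintype ι] (s : Finset X) (w : ι → X → ℝ) (t : X → ℝ) :
    ∑ c, ∑ x ∈ s, w c x * t x = ∑ x ∈ s, (∑ c, w c x) * t x := by
  rw [sum_comm]
  exact sum_congr rfl fun x _ => (sum_mul _ _ _).symm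

/-- kernel: the same with a constant prefactor. [folklore] -/
private theorem sum_mul_wsum {X ι : Type*} [Fintype ι] (a : ℝ) (s : Finset X) (w : ι → X → ℝ) (t : X → ℝ) :
    ∑ c, a * ∑ x ∈ s, w c x * t x = a * ∑ x ∈ s, (∑ c, w c x) * t x := by
  rw [← mul_sum, sum_wsum]

/-- kernel: the same with an overall minus sign. [folklore] -/
private theorem sum_neg_mul_wsum {X ι : Type*} [Fintype ι] (a : ℝ) (s : Finset X) (w : ι → X → ℝ) (t : X → ℝ) :
    ∑ c, -(a * ∑ x ∈ s, w c x * t x) = -(a * ∑ x ∈ s, (∑ c, w c x) * t x) := by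
  rw [sum_neg_distrib, sum_mul_wsum]

/-! ## §1 The polarized rules of (1.6)–(1.11) -/

section ScalarVector

variable (C : ChargeData N)

/-- **Polarized (1.6)** with a localization weight `w` on the position: one field per φ′-leg,
`−λ(L^kε) Σ_{x∈Ω₁} w(x) η^d (f₀(x)·f₁(x))(f₂(x)·f₃(x))`. [cite: Balaban1983Higgs3, (1.6) p.413] -/
def rule16 (lamRun : ℝ) (Ω₁ : Finset (HiggsLattice.Site P k)) (w : HiggsLattice.Site P k → ℝ) (f : Fin 4 → HiggsLattice.ScalarField P k N) : ℝ :=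
  -(lamRun * ∑ x ∈ Ω₁, w x * (P.mesh k ^ P.d * (⟪f 0 x, f 1 x⟫_ℝ * ⟪f 2 x, f 3 x⟫_ℝ)))

/-- On the diagonal (all legs the same field, weight 1) the polarized (1.6) IS the typer's (1.6) `vertex16`.
[cite: Balaban1983Higgs3, (1.6) p.413] -/
theorem rule16_diag (lamRun : ℝ) (Ω₁ : Finset (HiggsLattice.Site P k)) (φ : HiggsLattice.ScalarField P k N) :
    rule16 lamRun Ω₁ (fun _ => 1) (fun _ => φ) = vertex16 lamRun Ω₁ φ := by
  unfold rule16 vertex16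
  congr 1
  congr 1
  refine sum_congr rfl fun x _ => ?_
  rw [one_mul, real_inner_self_eq_norm_sq]
  ring

/-- (1.6) is linear in the localization weight: the sum over a family of weights. [cite: Balaban1983Higgs3, p.420] -/
theorem rule16_sum {ι : Type*} [Fintype ι] (lamRun : ℝ) (Ω₁ : Finset (HiggsLattice.Site P k)) (w : ι → HiggsLattice.Site P k → ℝ)
    (f : Fin 4 → HiggsLattice.ScalarField P k N) :
    ∑ c, rule16 lamRun Ω₁ (w c) f = rule16 lamRun Ω₁ (fun x => ∑ c, w c x) f := by
  simp only [rule16]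
  exact sum_neg_mul_wsum _ _ _ _

/-- **Polarized (1.7)**: `−½ Σ_{x∈Ω₁} w(x) η^d δm_i²(x)(L^kε)² (f₀(x)·f₁(x))`. [cite: Balaban1983Higgs3, (1.7) p.413] -/
def rule17 (dm2 : HiggsLattice.Site P k → ℝ) (ell : ℝ) (Ω₁ : Finset (HiggsLattice.Site P k)) (w : HiggsLattice.Site P k → ℝ) (f : Fin 2 → HiggsLattice.ScalarField P k N) : ℝ :=
  -(1 / 2 : ℝ) * ∑ x ∈ Ω₁, w x * (P.mesh k ^ P.d * dm2 x * ell ^ 2 * ⟪f 0 x, f 1 x⟫_ℝ)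

/-- On the diagonal the polarized (1.7) is the typer's `vertex17`. [cite: Balaban1983Higgs3, (1.7) p.413] -/
theorem rule17_diag (dm2 : HiggsLattice.Site P k → ℝ) (ell : ℝ) (Ω₁ : Finset (HiggsLattice.Site P k)) (φ : HiggsLattice.ScalarField P k N) :
    rule17 dm2 ell Ω₁ (fun _ => 1) (fun _ => φ) = vertex17 dm2 ell Ω₁ φ := by
  unfold rule17 vertex17
  congr 1
  refine sum_congr rfl fun x _ => ?_
  rw [one_mul, real_inner_self_eq_norm_sq]

/-- (1.7) is linear in the localization weight. [cite: Balaban1983Higgs3, p.420] -/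
theorem rule17_sum {ι : Type*} [Fintype ι] (dm2 : HiggsLattice.Site P k → ℝ) (ell : ℝ) (Ω₁ : Finset (HiggsLattice.Site P k))
    (w : ι → HiggsLattice.Site P k → ℝ) (f : Fin 2 → HiggsLattice.ScalarField P k N) :
    ∑ c, rule17 dm2 ell Ω₁ (w c) f = rule17 dm2 ell Ω₁ (fun x => ∑ c, w c x) f := by
  simp only [rule17]
  exact sum_mul_wsum _ _ _ _

/-- The POLARIZED leg bracket of (1.8)/(1.9): `[(D^η_B̃ f₀)(b)·T f₁(b₋)]`. [cite: Balaban1983Higgs3, (1.8) p.413] -/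
def pleg18 (B : HiggsLattice.VecField P k) (f₀ f₁ : HiggsLattice.ScalarField P k N) (T : Op N) (b : HiggsLattice.PBond P k) : ℝ :=
  ⟪covDeriv C B f₀ b, T (f₁ b.src)⟫_ℝ

/-- On the diagonal the polarized bracket is the typer's `leg18`. [cite: Balaban1983Higgs3, (1.8) p.413] -/
theorem pleg18_diag (B : HiggsLattice.VecField P k) (φ : HiggsLattice.ScalarField P k N) (T : Op N) (b : HiggsLattice.PBond P k) :
    pleg18 C B φ φ T b = leg18 C B φ T b := rfl

/-- The polarized leg bracket of (1.10)/(1.11): `[f₀(b₋)·T f₁(b₋)]`. [cite: Balaban1983Higgs3, (1.10) p.413] -/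
def pleg110 (f₀ f₁ : HiggsLattice.ScalarField P k N) (T : Op N) (b : HiggsLattice.PBond P k) : ℝ :=
  ⟪f₀ b.src, T (f₁ b.src)⟫_ℝ

/-- On the diagonal: the typer's `leg110`. [cite: Balaban1983Higgs3, (1.10) p.413] -/
theorem pleg110_diag (φ : HiggsLattice.ScalarField P k N) (T : Op N) (b : HiggsLattice.PBond P k) : pleg110 φ φ T b = leg110 φ T b := rfl

/-- The POLARIZED A′-legs of (1.8)–(1.11): one fluctuation field per leg, `Π_j g_k(b₋)·a_j(b)` (diagonal: `(g_kA′_b)^n`).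
[cite: Balaban1983Higgs3, (1.8) p.413] -/
def vlegs (g : HiggsLattice.Site P k → ℝ) {n : ℕ} (a : Fin n → HiggsLattice.VecField P k) (b : HiggsLattice.PBond P k) : ℝ := ∏ j : Fin n, g b.src * a j b

/-- On the diagonal the polarized A′-legs are the power `(g_kA′_b)^n`. [cite: Balaban1983Higgs3, (1.8) p.413] -/
theorem vlegs_diag (g : HiggsLattice.Site P k → ℝ) (n : ℕ) (A1 : HiggsLattice.VecField P k) (b : HiggsLattice.PBond P k) :
    vlegs g (fun _ : Fin n => A1) b = (g b.src * A1 b) ^ n := by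
  simp [vlegs]

/-- **Polarized (1.8)** with a localization weight `w` on the bond:
`e^{n+n′}((−1)^{n+n′}η^{n+n′−1}/(n!n′!)) Σ_{b∈S} w(b) η^d [(D^η_B̃f₀)(b)·q^{n+n′}f₁(b₋)] Π_j(g_k a_j)_b (Ã_b)^{n′}`.
[cite: Balaban1983Higgs3, (1.8) p.413] -/
def rule18 (g : HiggsLattice.Site P k → ℝ) (B At : HiggsLattice.VecField P k) (n n' : ℕ) (S : Finset (HiggsLattice.PBond P k)) (w : HiggsLattice.PBond P k → ℝ)
    (f : Fin 2 → HiggsLattice.ScalarField P k N) (a : Fin n → HiggsLattice.VecField P k) : ℝ :=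
  C.e ^ (n + n') * ((-1 : ℝ) ^ (n + n') * P.mesh k ^ ((n + n' : ℤ) - 1) / ((n.factorial : ℝ) * n'.factorial))
    * ∑ b ∈ S, w b * (P.mesh k ^ P.d * pleg18 C B (f 0) (f 1) (C.q ^ (n + n')) b * vlegs g a b * At b ^ n')

/-- On the diagonal the polarized (1.8) is the typer's `vertex18`. [cite: Balaban1983Higgs3, (1.8) p.413] -/
theorem rule18_diag (g : HiggsLattice.Site P k → ℝ) (B A1 At : HiggsLattice.VecField P k) (φ : HiggsLattice.ScalarField P k N) (n n' : ℕ)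
    (S : Finset (HiggsLattice.PBond P k)) :
    rule18 C g B At n n' S (fun _ => 1) (fun _ => φ) (fun _ => A1) = vertex18 C g B A1 At φ n n' S := by
  unfold rule18 vertex18
  congr 1
  refine sum_congr rfl fun b _ => ?_
  rw [one_mul, vlegs_diag]
  rfl

/-- (1.8) is linear in the localization weight. [cite: Balaban1983Higgs3, p.420] -/
theorem rule18_sum {ι : Type*} [Fintype ι] (g : HiggsLattice.Site P k → ℝ) (B At : HiggsLattice.VecField P k) (n n' : ℕ)
    (S : Finset (HiggsLattice.PBond P k)) (w : ι → HiggsLattice.PBond P k → ℝ) (f : Fin 2 → HiggsLattice.ScalarField P k N) (a : Fin n → HiggsLattice.VecField P k) :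
    ∑ c, rule18 C g B At n n' S (w c) f a = rule18 C g B At n n' S (fun b => ∑ c, w c b) f a := by
  simp only [rule18]
  exact sum_mul_wsum _ _ _ _

/-- **Polarized (1.9)** (the R-vertex of (1.8); the tensor `q^{n+n̄+1}R_{n̄+1}(−ηqeÃ_b)` = the typer's `remTensor`).
[cite: Balaban1983Higgs3, (1.9) p.413] -/
def rule19 (g : HiggsLattice.Site P k → ℝ) (B At : HiggsLattice.VecField P k) (nbar n : ℕ) (S : Finset (HiggsLattice.PBond P k)) (w : HiggsLattice.PBond P k → ℝ)
    (f : Fin 2 → HiggsLattice.ScalarField P k N) (a : Fin n → HiggsLattice.VecField P k) : ℝ :=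
  C.e ^ (n + nbar + 1)
      * ((-1 : ℝ) ^ (n + nbar + 1) * P.mesh k ^ (n + nbar) / ((n.factorial : ℝ) * (nbar + 1).factorial))
    * ∑ b ∈ S, w b * (P.mesh k ^ P.d * pleg18 C B (f 0) (f 1) (C.q ^ (n + nbar + 1) * remTensor C nbar At b) b
        * vlegs g a b * At b ^ (nbar + 1))

/-- On the diagonal the polarized (1.9) is the typer's `vertex19`. [cite: Balaban1983Higgs3, (1.9) p.413] -/
theorem rule19_diag (g : HiggsLattice.Site P k → ℝ) (B A1 At : HiggsLattice.VecField P k) (φ : HiggsLattice.ScalarField P k N) (nbar n : ℕ)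
    (S : Finset (HiggsLattice.PBond P k)) :
    rule19 C g B At nbar n S (fun _ => 1) (fun _ => φ) (fun _ => A1) = vertex19 C g B A1 At φ nbar n S := by
  unfold rule19 vertex19
  congr 1
  refine sum_congr rfl fun b _ => ?_
  rw [one_mul, vlegs_diag]
  rfl

/-- (1.9) is linear in the localization weight. [cite: Balaban1983Higgs3, p.420] -/
theorem rule19_sum {ι : Type*} [Fintype ι] (g : HiggsLattice.Site P k → ℝ) (B At : HiggsLattice.VecField P k) (nbar n : ℕ)
    (S : Finset (HiggsLattice.PBond P k)) (w : ι → HiggsLattice.PBond P k → ℝ) (f : Fin 2 → HiggsLattice.ScalarField P k N) (a : Fin n → HiggsLattice.VecField P k) :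
    ∑ c, rule19 C g B At nbar n S (w c) f a = rule19 C g B At nbar n S (fun b => ∑ c, w c b) f a := by
  simp only [rule19]
  exact sum_mul_wsum _ _ _ _

/-- **Polarized (1.10)**: `e^{n+n′}(η^{n+n′−2}/(n!n′!)) Σ_{b∈S} w(b) η^d [f₀(b₋)·q^{n+n′}f₁(b₋)] Π_j(g_k a_j)_b (Ã_b)^{n′}`.
[cite: Balaban1983Higgs3, (1.10) p.413] -/
def rule110 (g : HiggsLattice.Site P k → ℝ) (At : HiggsLattice.VecField P k) (n n' : ℕ) (S : Finset (HiggsLattice.PBond P k)) (w : HiggsLattice.PBond P k → ℝ)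
    (f : Fin 2 → HiggsLattice.ScalarField P k N) (a : Fin n → HiggsLattice.VecField P k) : ℝ :=
  C.e ^ (n + n') * (P.mesh k ^ ((n + n' : ℤ) - 2) / ((n.factorial : ℝ) * n'.factorial))
    * ∑ b ∈ S, w b * (P.mesh k ^ P.d * pleg110 (f 0) (f 1) (C.q ^ (n + n')) b * vlegs g a b * At b ^ n')

/-- On the diagonal the polarized (1.10) is the typer's `vertex110`. [cite: Balaban1983Higgs3, (1.10) p.413] -/
theorem rule110_diag (g : HiggsLattice.Site P k → ℝ) (A1 At : HiggsLattice.VecField P k) (φ : HiggsLattice.ScalarField P k N) (n n' : ℕ)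
    (S : Finset (HiggsLattice.PBond P k)) :
    rule110 C g At n n' S (fun _ => 1) (fun _ => φ) (fun _ => A1) = vertex110 C g A1 At φ n n' S := by
  unfold rule110 vertex110
  congr 1
  refine sum_congr rfl fun b _ => ?_
  rw [one_mul, vlegs_diag]
  rfl

/-- (1.10) is linear in the localization weight. [cite: Balaban1983Higgs3, p.420] -/
theorem rule110_sum {ι : Type*} [Fintype ι] (g : HiggsLattice.Site P k → ℝ) (At : HiggsLattice.VecField P k) (n n' : ℕ)
    (S : Finset (HiggsLattice.PBond P k)) (w : ι → HiggsLattice.PBond P k → ℝ) (f : Fin 2 → HiggsLattice.ScalarField P k N) (a : Fin n → HiggsLattice.VecField P k) :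
    ∑ c, rule110 C g At n n' S (w c) f a = rule110 C g At n n' S (fun b => ∑ c, w c b) f a := by
  simp only [rule110]
  exact sum_mul_wsum _ _ _ _

/-- **Polarized (1.11)** (the R-vertex of (1.10)). [cite: Balaban1983Higgs3, (1.11) p.413] -/
def rule111 (g : HiggsLattice.Site P k → ℝ) (At : HiggsLattice.VecField P k) (nbar n : ℕ) (S : Finset (HiggsLattice.PBond P k)) (w : HiggsLattice.PBond P k → ℝ)
    (f : Fin 2 → HiggsLattice.ScalarField P k N) (a : Fin n → HiggsLattice.VecField P k) : ℝ :=
  C.e ^ (n + nbar + 1)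
      * ((-1 : ℝ) ^ (n + nbar + 1) * P.mesh k ^ ((n + nbar : ℤ) - 1) / ((n.factorial : ℝ) * (nbar + 1).factorial))
    * ∑ b ∈ S, w b * (P.mesh k ^ P.d * pleg110 (f 0) (f 1) (C.q ^ (n + nbar + 1) * remTensor C nbar At b) b
        * vlegs g a b * At b ^ (nbar + 1))

/-- On the diagonal the polarized (1.11) is the typer's `vertex111`. [cite: Balaban1983Higgs3, (1.11) p.413] -/
theorem rule111_diag (g : HiggsLattice.Site P k → ℝ) (A1 At : HiggsLattice.VecField P k) (φ : HiggsLattice.ScalarField P k N) (nbar n : ℕ)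
    (S : Finset (HiggsLattice.PBond P k)) :
    rule111 C g At nbar n S (fun _ => 1) (fun _ => φ) (fun _ => A1) = vertex111 C g A1 At φ nbar n S := by
  unfold rule111 vertex111
  congr 1
  refine sum_congr rfl fun b _ => ?_
  rw [one_mul, vlegs_diag]
  rfl

/-- (1.11) is linear in the localization weight. [cite: Balaban1983Higgs3, p.420] -/
theorem rule111_sum {ι : Type*} [Fintype ι] (g : HiggsLattice.Site P k → ℝ) (At : HiggsLattice.VecField P k) (nbar n : ℕ)
    (S : Finset (HiggsLattice.PBond P k)) (w : ι → HiggsLattice.PBond P k → ℝ) (f : Fin 2 → HiggsLattice.ScalarField P k N) (a : Fin n → HiggsLattice.VecField P k) :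
    ∑ c, rule111 C g At nbar n S (w c) f a = rule111 C g At nbar n S (fun b => ∑ c, w c b) f a := by
  simp only [rule111]
  exact sum_mul_wsum _ _ _ _

end ScalarVector

/-! ## §2 The polarized rules of the averaging vertices (1.13)–(1.15), with level-`k` output fields -/

section Averaging

variable (C : ChargeData N)

/-- **Polarized (1.13) with output field**: the averaging expression `−(Q_k(B̃)f₀)(y)` is a `W`-valued function of the
block point `y ∈ T₁^{(k)} ∩ Ω`; read against an output co-field `o₀` with a localization weight `w_Y` on `y` (point
localization p. 420 = the weight `[· = y]`): `Σ_{y∈Y} w_Y(y)·(o₀(y)·(−(Q_k(B̃)f₀)(y)))`. [cite: Balaban1983Higgs3, (1.13) p.413] -/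
def rule113 (w : ℝ) (β : HiggsLattice.Site P 0 → ℝ) (k : ℕ) (Y : Finset (HiggsLattice.Site P k)) (wY : HiggsLattice.Site P k → ℝ)
    (f : Fin 1 → HiggsLattice.ScalarField P 0 N) (o : Fin 1 → HiggsLattice.ScalarField P k N) : ℝ :=
  ∑ y ∈ Y, wY y * ⟪o 0 y, vertex113 C w β (f 0) k y⟫_ℝ

/-- Localized at the point `y` (weight 1 on `{y}`) the polarized (1.13) is the pairing of the output co-field with the
typer's `vertex113` at `y`. [cite: Balaban1983Higgs3, (1.13) p.413] -/
theorem rule113_point (w : ℝ) (β : HiggsLattice.Site P 0 → ℝ) (k : ℕ) (y : HiggsLattice.Site P k) (φ' : HiggsLattice.ScalarField P 0 N)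
    (o : Fin 1 → HiggsLattice.ScalarField P k N) :
    rule113 C w β k {y} (fun _ => 1) (fun _ => φ') o = ⟪o 0 y, vertex113 C w β φ' k y⟫_ℝ := by
  simp [rule113]

/-- (1.13) is linear in the localization weight. [cite: Balaban1983Higgs3, p.420] -/
theorem rule113_sum {ι : Type*} [Fintype ι] (w : ℝ) (β : HiggsLattice.Site P 0 → ℝ) (k : ℕ) (Y : Finset (HiggsLattice.Site P k))
    (wY : ι → HiggsLattice.Site P k → ℝ) (f : Fin 1 → HiggsLattice.ScalarField P 0 N) (o : Fin 1 → HiggsLattice.ScalarField P k N) :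
    ∑ c, rule113 C w β k Y (wY c) f o = rule113 C w β k Y (fun y => ∑ c, wY c y) f o := by
  simp only [rule113]
  exact sum_wsum _ _ _

/-- **Polarized (1.14) at the point `y`**: one fluctuation field per A′-leg, entering through the contour functional
`ctr a x = a(Γ^{(k)}_{y,x})` (the tree's `HiggsAveraging.multiContourSum · k`, resp. `B3Eq15ChargeDerivative.etaSumK` /
`Data14.fluctContour` in the multiscale reading (1.3)):
`−e^{n+n′}(1/(n!n′!)) Σ_{x∈B^k(y)} w (Π_j a_j(Γ^{(k)}_{y,x})) (Ã(Γ))^{n′} q^{n+n′}U(B̃(Γ))f₀(x)`. [cite: Balaban1983Higgs3, (1.14) p.413] -/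
def avg114 (w : ℝ) (β τ : HiggsLattice.Site P 0 → ℝ) (ctr : HiggsLattice.VecField P 0 → HiggsLattice.Site P 0 → ℝ) (k n n' : ℕ) (y : HiggsLattice.Site P k)
    (f₀ : HiggsLattice.ScalarField P 0 N) (a : Fin n → HiggsLattice.VecField P 0) : E N :=
  -((C.e ^ (n + n') * (1 / ((n.factorial : ℝ) * n'.factorial)))
      • (w • ∑ x ∈ blockK k y, ((∏ j : Fin n, ctr (a j) x) * τ x ^ n') • (C.q ^ (n + n')) (C.U 1 (β x) (f₀ x))))

/-- On the diagonal (all A′-legs the same field `A′`, `α = ctr A′`) the polarized (1.14) is the typer's `vertex114`.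
[cite: Balaban1983Higgs3, (1.14) p.413] -/
theorem avg114_diag (w : ℝ) (β τ : HiggsLattice.Site P 0 → ℝ) (ctr : HiggsLattice.VecField P 0 → HiggsLattice.Site P 0 → ℝ) (k n n' : ℕ) (y : HiggsLattice.Site P k)
    (φ' : HiggsLattice.ScalarField P 0 N) (A1 : HiggsLattice.VecField P 0) :
    avg114 C w β τ ctr k n n' y φ' (fun _ => A1) = vertex114 C w β (ctr A1) τ φ' k n n' y := by
  unfold avg114 vertex114
  simp only [Fin.prod_const]

/-- **Polarized (1.14) with output field** (sum over the block points with the localization weight `w_Y`).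
[cite: Balaban1983Higgs3, (1.14) p.413] -/
def rule114 (w : ℝ) (β τ : HiggsLattice.Site P 0 → ℝ) (ctr : HiggsLattice.VecField P 0 → HiggsLattice.Site P 0 → ℝ) (k n n' : ℕ) (Y : Finset (HiggsLattice.Site P k))
    (wY : HiggsLattice.Site P k → ℝ) (f : Fin 1 → HiggsLattice.ScalarField P 0 N) (a : Fin n → HiggsLattice.VecField P 0) (o : Fin 1 → HiggsLattice.ScalarField P k N) : ℝ :=
  ∑ y ∈ Y, wY y * ⟪o 0 y, avg114 C w β τ ctr k n n' y (f 0) a⟫_ℝ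

/-- Localized at `y`, on the diagonal: the pairing of the output co-field with the typer's `vertex114` at `y`.
[cite: Balaban1983Higgs3, (1.14) p.413] -/
theorem rule114_point (w : ℝ) (β τ : HiggsLattice.Site P 0 → ℝ) (ctr : HiggsLattice.VecField P 0 → HiggsLattice.Site P 0 → ℝ) (k n n' : ℕ) (y : HiggsLattice.Site P k)
    (φ' : HiggsLattice.ScalarField P 0 N) (A1 : HiggsLattice.VecField P 0) (o : Fin 1 → HiggsLattice.ScalarField P k N) :
    rule114 C w β τ ctr k n n' {y} (fun _ => 1) (fun _ => φ') (fun _ => A1) o =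
      ⟪o 0 y, vertex114 C w β (ctr A1) τ φ' k n n' y⟫_ℝ := by
  simp [rule114, avg114_diag]

/-- (1.14) is linear in the localization weight. [cite: Balaban1983Higgs3, p.420] -/
theorem rule114_sum {ι : Type*} [Fintype ι] (w : ℝ) (β τ : HiggsLattice.Site P 0 → ℝ) (ctr : HiggsLattice.VecField P 0 → HiggsLattice.Site P 0 → ℝ)
    (k n n' : ℕ) (Y : Finset (HiggsLattice.Site P k)) (wY : ι → HiggsLattice.Site P k → ℝ) (f : Fin 1 → HiggsLattice.ScalarField P 0 N)
    (a : Fin n → HiggsLattice.VecField P 0) (o : Fin 1 → HiggsLattice.ScalarField P k N) :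
    ∑ c, rule114 C w β τ ctr k n n' Y (wY c) f a o = rule114 C w β τ ctr k n n' Y (fun y => ∑ c, wY c y) f a o := by
  simp only [rule114]
  exact sum_wsum _ _ _

/-- **Polarized (1.15) at the point `y`** (the R-vertex of (1.14); `R_{n̄+1}` = r15's `taylorRemOp n̄`).
[cite: Balaban1983Higgs3, (1.15) p.414] -/
def avg115 (w : ℝ) (β τ : HiggsLattice.Site P 0 → ℝ) (ctr : HiggsLattice.VecField P 0 → HiggsLattice.Site P 0 → ℝ) (k nbar n : ℕ) (y : HiggsLattice.Site P k)
    (f₀ : HiggsLattice.ScalarField P 0 N) (a : Fin n → HiggsLattice.VecField P 0) : E N :=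
  -((C.e ^ (n + nbar + 1) * (1 / ((n.factorial : ℝ) * (nbar + 1).factorial)))
      • (w • ∑ x ∈ blockK k y, ((∏ j : Fin n, ctr (a j) x) * τ x ^ (nbar + 1))
          • ((C.q ^ (n + nbar + 1) * taylorRemOp nbar ((C.e * τ x) • C.q)) (C.U 1 (β x) (f₀ x)))))

/-- On the diagonal the polarized (1.15) is the typer's `vertex115`. [cite: Balaban1983Higgs3, (1.15) p.414] -/
theorem avg115_diag (w : ℝ) (β τ : HiggsLattice.Site P 0 → ℝ) (ctr : HiggsLattice.VecField P 0 → HiggsLattice.Site P 0 → ℝ) (k nbar n : ℕ) (y : HiggsLattice.Site P k)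
    (φ' : HiggsLattice.ScalarField P 0 N) (A1 : HiggsLattice.VecField P 0) :
    avg115 C w β τ ctr k nbar n y φ' (fun _ => A1) = vertex115 C w β (ctr A1) τ φ' k nbar n y := by
  unfold avg115 vertex115
  simp only [Fin.prod_const]

/-- **Polarized (1.15) with output field**. [cite: Balaban1983Higgs3, (1.15) p.414] -/
def rule115 (w : ℝ) (β τ : HiggsLattice.Site P 0 → ℝ) (ctr : HiggsLattice.VecField P 0 → HiggsLattice.Site P 0 → ℝ) (k nbar n : ℕ) (Y : Finset (HiggsLattice.Site P k))
    (wY : HiggsLattice.Site P k → ℝ) (f : Fin 1 → HiggsLattice.ScalarField P 0 N) (a : Fin n → HiggsLattice.VecField P 0) (o : Fin 1 → HiggsLattice.ScalarField P k N) : ℝ :=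
  ∑ y ∈ Y, wY y * ⟪o 0 y, avg115 C w β τ ctr k nbar n y (f 0) a⟫_ℝ

/-- Localized at `y`, on the diagonal: the pairing with the typer's `vertex115` at `y`. [cite: Balaban1983Higgs3, (1.15) p.414] -/
theorem rule115_point (w : ℝ) (β τ : HiggsLattice.Site P 0 → ℝ) (ctr : HiggsLattice.VecField P 0 → HiggsLattice.Site P 0 → ℝ) (k nbar n : ℕ) (y : HiggsLattice.Site P k)
    (φ' : HiggsLattice.ScalarField P 0 N) (A1 : HiggsLattice.VecField P 0) (o : Fin 1 → HiggsLattice.ScalarField P k N) :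
    rule115 C w β τ ctr k nbar n {y} (fun _ => 1) (fun _ => φ') (fun _ => A1) o =
      ⟪o 0 y, vertex115 C w β (ctr A1) τ φ' k nbar n y⟫_ℝ := by
  simp [rule115, avg115_diag]

/-- (1.15) is linear in the localization weight. [cite: Balaban1983Higgs3, p.420] -/
theorem rule115_sum {ι : Type*} [Fintype ι] (w : ℝ) (β τ : HiggsLattice.Site P 0 → ℝ) (ctr : HiggsLattice.VecField P 0 → HiggsLattice.Site P 0 → ℝ)
    (k nbar n : ℕ) (Y : Finset (HiggsLattice.Site P k)) (wY : ι → HiggsLattice.Site P k → ℝ) (f : Fin 1 → HiggsLattice.ScalarField P 0 N)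
    (a : Fin n → HiggsLattice.VecField P 0) (o : Fin 1 → HiggsLattice.ScalarField P k N) :
    ∑ c, rule115 C w β τ ctr k nbar n Y (wY c) f a o = rule115 C w β τ ctr k nbar n Y (fun y => ∑ c, wY c y) f a o := by
  simp only [rule115]
  exact sum_wsum _ _ _

end Averaging

/-! ## §3 Assembly: the rules of a graph on p18's `Graph`, and its expression -/

section Assembly

/-- **MODEL DATA of the step-`k` expansion**, common to all vertices of a graph: the charge data (`e(L^kε)`, `q`, `U`), the
running coupling `λ(L^kε)`, the length `L^kε` of (1.7), the regions `Ω₁` (sites of (1.6)/(1.7)) and the bonds summed in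
(1.8)–(1.11), the cut-off `g_k`, the background `B̃` and the small field `Ã`, the averaging weight `η^d` and the contour
values `B̃(Γ^{(k)}_{y,x})`, `Ã(Γ^{(k)}_{y,x})`, the contour functional of the A′-legs of (1.14)/(1.15), and the block points
`T₁^{(k)} ∩ Ω`. [cite: Balaban1983Higgs3, (1.4)–(1.15) pp.412–414] -/
structure Model (P : HiggsLattice.Params) (N k : ℕ) where
  /-- the charge data `e = e(L^kε)`, `q`, `U`. -/
  C : ChargeData N
  /-- `λ(L^kε)`. -/
  lamRun : ℝ
  /-- `L^kε` in (1.7). -/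
  ell : ℝ
  /-- `Ω₁` (the sites summed in (1.6), (1.7)). -/
  Ω₁ : Finset (HiggsLattice.Site P 0)
  /-- the bonds summed in (1.8)–(1.11). -/
  S : Finset (HiggsLattice.PBond P 0)
  /-- the cut-off function `g_k` of (1.4). -/
  g : HiggsLattice.Site P 0 → ℝ
  /-- the background field `B̃`. -/
  B : HiggsLattice.VecField P 0
  /-- the small external field `Ã`. -/
  At : HiggsLattice.VecField P 0
  /-- the averaging weight `η^d` of (1.13)–(1.15). -/
  w : ℝ
  /-- `x ↦ B̃(Γ^{(k)}_{y,x})`. -/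
  β : HiggsLattice.Site P 0 → ℝ
  /-- `x ↦ Ã(Γ^{(k)}_{y,x})`. -/
  τ : HiggsLattice.Site P 0 → ℝ
  /-- the contour functional `a ↦ (x ↦ a(Γ^{(k)}_{y,x}))` of the A′-legs of (1.14)/(1.15). -/
  ctr : HiggsLattice.VecField P 0 → HiggsLattice.Site P 0 → ℝ
  /-- the block points `T₁^{(k)} ∩ Ω` (*"finally we sum over y ∈ T₁^{(k)} ∩ Ω"*, p. 414). -/
  Y : Finset (HiggsLattice.Site P k)

/-- **LOCALIZATION DATA of one vertex** (p. 420): a weight on the sites (for (1.6), (1.7): the indicator of a unit cube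
□(v)), a weight on the bonds (for the vector-leg vertices (1.8)–(1.11): a member of the smooth partition of unity, one
factor per vector leg), a weight on the block points (for (1.13)–(1.15): the point mass at `y`). [cite: Balaban1983Higgs3, p.420] -/
@[ext]
structure Loc (P : HiggsLattice.Params) (k : ℕ) where
  /-- weight on the sites of `T_η`. -/
  wS : HiggsLattice.Site P 0 → ℝ
  /-- weight on the bonds of `T_η`. -/
  wB : HiggsLattice.PBond P 0 → ℝ
  /-- weight on the block points `T₁^{(k)}`. -/
  wY : HiggsLattice.Site P k → ℝ

/-- The trivial localization (all weights 1): the unlocalized vertex. [cite: Balaban1983Higgs3, p.420] -/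
def Loc.triv : Loc P k := ⟨fun _ => 1, fun _ => 1, fun _ => 1⟩

/-- The pointwise sum of a finite family of localizations. [cite: Balaban1983Higgs3, p.420] -/
def Loc.sum {ι : Type*} [Fintype ι] (l : ι → Loc P k) : Loc P k :=
  ⟨fun x => ∑ c, (l c).wS x, fun b => ∑ c, (l c).wB b, fun y => ∑ c, (l c).wY y⟩

/-- The POSITION SPECIES in which a vertex is localized (p. 420): the sites of `T_η` (unit cubes) for (1.6), (1.7); the
bonds (a smooth partition of unity, one member per vector leg) for (1.8)–(1.11); the block points `y ∈ T₁^{(k)} ∩ Ω` for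
(1.13)–(1.15). [cite: Balaban1983Higgs3, p.420] -/
inductive Species
  /-- localized in the sites (unit cubes □(v)): (1.6), (1.7). -/
  | site
  /-- localized in the bonds (smooth partition of unity): (1.8)–(1.11). -/
  | bond
  /-- localized in the block points: (1.13)–(1.15). -/
  | point
  deriving DecidableEq

/-- The species of each catalogue vertex (p. 420 ¶1). [cite: Balaban1983Higgs3, p.420] -/
def speciesOf : VertexKind → Species
  | .v16 => .site
  | .v17 => .site
  | .v18 _ _ => .bond
  | .v19 _ _ => .bond
  | .v110 _ _ => .bond
  | .v111 _ _ => .bond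
  | .v113 => .point
  | .v114 _ _ => .point
  | .v115 _ _ => .point

/-- Two localizations AGREE FOR a kind when their weights on its species coincide. [cite: Balaban1983Higgs3, p.420] -/
def Loc.AgreeFor (κ : VertexKind) (l l' : Loc P k) : Prop :=
  match speciesOf κ with
  | .site => l.wS = l'.wS
  | .bond => l.wB = l'.wB
  | .point => l.wY = l'.wY

/-- A finite family of localizations of a vertex of kind `κ` is a PARTITION when its weights on the species of `κ` sum
to 1 pointwise (the unit cubes cover `T_η`; `Σ_□ χ_□ = 1` for the smooth partition, `B3SmoothLocalization420.sum_chi`; the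
points of `T₁^{(k)}`). [cite: Balaban1983Higgs3, p.420] -/
def Loc.IsPartitionFor {ι : Type*} [Fintype ι] (κ : VertexKind) (l : ι → Loc P k) : Prop :=
  Loc.AgreeFor κ (Loc.sum l) Loc.triv

/-- **Unit-cube localization** (for (1.6), (1.7)): the site weight = the indicator of the cube `B^{k′}(y)` of the
`η`-lattice (unit cubes: `k′ = k`), bonds and points unweighted. [cite: Balaban1983Higgs3, p.420] -/
def Loc.cube {k' : ℕ} (y : HiggsLattice.Site P k') : Loc P k :=
  ⟨fun x => if blockIter k' x = y then 1 else 0, fun _ => 1, fun _ => 1⟩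

/-- **Smooth localization of a vector-leg vertex** (for (1.8)–(1.11)): one member `χ_{c_j}` of a partition of unity on the
sites per vector leg `j`, read at the initial point of the vertex's bond: bond weight `Π_j χ_{c_j}(b₋)`.
[cite: Balaban1983Higgs3, p.420] -/
def Loc.legProd {ι : Type*} (χ : ι → HiggsLattice.Site P 0 → ℝ) {n : ℕ} (c : Fin n → ι) : Loc P k :=
  ⟨fun _ => 1, fun b => ∏ j : Fin n, χ (c j) b.src, fun _ => 1⟩

/-- **Point localization** at a block point `y ∈ T₁^{(k)}` (for (1.13)–(1.15)). [cite: Balaban1983Higgs3, p.420] -/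
def Loc.point (y : HiggsLattice.Site P k) : Loc P k := ⟨fun _ => 1, fun _ => 1, fun y' => if y' = y then 1 else 0⟩

/-- The unit cubes form a partition for the site-localized kinds. [cite: Balaban1983Higgs3, p.420] -/
theorem isPartitionFor_cube {k' : ℕ} (κ : VertexKind) (hκ : speciesOf κ = .site) :
    Loc.IsPartitionFor κ (fun y : HiggsLattice.Site P k' => (Loc.cube y : Loc P k)) := by
  unfold Loc.IsPartitionFor Loc.AgreeFor
  rw [hκ]
  funext x
  simp [Loc.sum, Loc.cube, Loc.triv]

/-- Products of members of a partition of unity `Σ_c χ_c = 1`, one per vector leg, form a partition for the bond-localized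
kinds (`Σ_{c₁…c_n} Π_j χ_{c_j} = Π_j Σ_c χ_c = 1`). [cite: Balaban1983Higgs3, p.420] -/
theorem isPartitionFor_legProd {ι : Type*} [Fintype ι] (χ : ι → HiggsLattice.Site P 0 → ℝ) (hχ : ∀ x, ∑ c, χ c x = 1)
    (n : ℕ) (κ : VertexKind) (hκ : speciesOf κ = .bond) :
    Loc.IsPartitionFor κ (fun c : Fin n → ι => (Loc.legProd χ c : Loc P k)) := by
  unfold Loc.IsPartitionFor Loc.AgreeFor
  rw [hκ]
  funext b
  simp only [Loc.sum, Loc.legProd, Loc.triv]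
  rw [← Fintype.prod_sum fun (_ : Fin n) c => χ c b.src]
  simp [hχ]

/-- The points of `T₁^{(k)}` form a partition for the point-localized kinds. [cite: Balaban1983Higgs3, p.420] -/
theorem isPartitionFor_point (κ : VertexKind) (hκ : speciesOf κ = .point) :
    Loc.IsPartitionFor κ (fun y : HiggsLattice.Site P k => Loc.point y) := by
  unfold Loc.IsPartitionFor Loc.AgreeFor
  rw [hκ]
  funext y
  simp [Loc.sum, Loc.point, Loc.triv]

variable (k)

/-- **The Feynman rule of a vertex of kind `κ`** for the model data `M`, the counterterm `δm_i²` (used by (1.7) only: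
*"δm_i²(x) is one of the renormalization mass counterterms"*) and the localization `l`: the polarized catalogue rule of
§§1–2 of that kind, as an inhabitant of FILE 1's rule type (`scalarLegs κ` φ′-legs, `vectorLegs κ` A′-legs,
`outSlots κ` outputs). [cite: Balaban1983Higgs3, (1.6)–(1.15) pp.413–414] -/
def ruleOfKind (M : Model P N k) (dm2 : HiggsLattice.Site P 0 → ℝ) (l : Loc P k) :
    (κ : VertexKind) → (Fin κ.scalarLegs → HiggsLattice.ScalarField P 0 N) → (Fin κ.vectorLegs → HiggsLattice.VecField P 0) →
      (Fin (outSlots κ) → HiggsLattice.ScalarField P k N) → ℝ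
  | .v16, f, _, _ => rule16 M.lamRun M.Ω₁ l.wS f
  | .v17, f, _, _ => rule17 dm2 M.ell M.Ω₁ l.wS f
  | .v18 n n', f, a, _ => rule18 M.C M.g M.B M.At n n' M.S l.wB f a
  | .v19 n nb, f, a, _ => rule19 M.C M.g M.B M.At nb n M.S l.wB f a
  | .v110 n n', f, a, _ => rule110 M.C M.g M.At n n' M.S l.wB f a
  | .v111 n nb, f, a, _ => rule111 M.C M.g M.At nb n M.S l.wB f a
  | .v113, f, _, o => rule113 M.C M.w M.β k M.Y l.wY f o
  | .v114 n n', f, a, o => rule114 M.C M.w M.β M.τ M.ctr k n n' M.Y l.wY f a o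
  | .v115 n nb, f, a, o => rule115 M.C M.w M.β M.τ M.ctr k nb n M.Y l.wY f a o

variable {k}

/-- **The rule of every kind is linear in the localization**: summing over a family of localizations gives the rule of
the summed localization. [cite: Balaban1983Higgs3, p.420] -/
theorem ruleOfKind_sum {ι : Type*} [Fintype ι] (M : Model P N k) (dm2 : HiggsLattice.Site P 0 → ℝ) (l : ι → Loc P k)
    (κ : VertexKind) (f : Fin κ.scalarLegs → HiggsLattice.ScalarField P 0 N) (a : Fin κ.vectorLegs → HiggsLattice.VecField P 0)
    (o : Fin (outSlots κ) → HiggsLattice.ScalarField P k N) :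
    ∑ c, ruleOfKind k M dm2 (l c) κ f a o = ruleOfKind k M dm2 (Loc.sum l) κ f a o := by
  cases κ with
  | v16 => exact rule16_sum _ _ _ _
  | v17 => exact rule17_sum _ _ _ _ _
  | v18 n n' => exact rule18_sum _ _ _ _ _ _ _ _ _ _
  | v19 n nb => exact rule19_sum _ _ _ _ _ _ _ _ _ _
  | v110 n n' => exact rule110_sum _ _ _ _ _ _ _ _ _
  | v111 n nb => exact rule111_sum _ _ _ _ _ _ _ _ _
  | v113 => exact rule113_sum _ _ _ _ _ _ _ _
  | v114 n n' => exact rule114_sum _ _ _ _ _ _ _ _ _ _ _ _ _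
  | v115 n nb => exact rule115_sum _ _ _ _ _ _ _ _ _ _ _ _ _

/-- The rule of a kind depends on the localization only through the weight on ITS species. [cite: Balaban1983Higgs3, p.420] -/
theorem ruleOfKind_congr (M : Model P N k) (dm2 : HiggsLattice.Site P 0 → ℝ) {l l' : Loc P k} (κ : VertexKind)
    (h : Loc.AgreeFor κ l l') (f : Fin κ.scalarLegs → HiggsLattice.ScalarField P 0 N)
    (a : Fin κ.vectorLegs → HiggsLattice.VecField P 0) (o : Fin (outSlots κ) → HiggsLattice.ScalarField P k N) :
    ruleOfKind k M dm2 l κ f a o = ruleOfKind k M dm2 l' κ f a o := by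
  cases κ <;> simp only [Loc.AgreeFor, speciesOf] at h <;> simp only [ruleOfKind, h]

/-- **Summing a vertex's rule over a partition of localizations gives the unlocalized rule.** [cite: Balaban1983Higgs3, p.420] -/
theorem ruleOfKind_partition {ι : Type*} [Fintype ι] (M : Model P N k) (dm2 : HiggsLattice.Site P 0 → ℝ) (l : ι → Loc P k)
    (κ : VertexKind) (hl : Loc.IsPartitionFor κ l) (f : Fin κ.scalarLegs → HiggsLattice.ScalarField P 0 N)
    (a : Fin κ.vectorLegs → HiggsLattice.VecField P 0) (o : Fin (outSlots κ) → HiggsLattice.ScalarField P k N) :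
    ∑ c, ruleOfKind k M dm2 (l c) κ f a o = ruleOfKind k M dm2 Loc.triv κ f a o := by
  rw [ruleOfKind_sum]
  exact ruleOfKind_congr M dm2 κ hl f a o

/-- With the trivial localization the rule of kind (1.6) on the diagonal is the typer's (1.6). [cite: Balaban1983Higgs3, (1.6) p.413] -/
theorem ruleOfKind_v16_diag (M : Model P N k) (dm2 : HiggsLattice.Site P 0 → ℝ) (φ : HiggsLattice.ScalarField P 0 N)
    (a : Fin 0 → HiggsLattice.VecField P 0) (o : Fin 0 → HiggsLattice.ScalarField P k N) :
    ruleOfKind k M dm2 Loc.triv .v16 (fun _ => φ) a o = vertex16 M.lamRun M.Ω₁ φ :=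
  rule16_diag _ _ _

/-- … kind (1.7). [cite: Balaban1983Higgs3, (1.7) p.413] -/
theorem ruleOfKind_v17_diag (M : Model P N k) (dm2 : HiggsLattice.Site P 0 → ℝ) (φ : HiggsLattice.ScalarField P 0 N)
    (a : Fin 0 → HiggsLattice.VecField P 0) (o : Fin 0 → HiggsLattice.ScalarField P k N) :
    ruleOfKind k M dm2 Loc.triv .v17 (fun _ => φ) a o = vertex17 dm2 M.ell M.Ω₁ φ :=
  rule17_diag _ _ _ _

/-- … kind (1.8). [cite: Balaban1983Higgs3, (1.8) p.413] -/
theorem ruleOfKind_v18_diag (M : Model P N k) (dm2 : HiggsLattice.Site P 0 → ℝ) (n n' : ℕ) (φ : HiggsLattice.ScalarField P 0 N)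
    (A1 : HiggsLattice.VecField P 0) (o : Fin 0 → HiggsLattice.ScalarField P k N) :
    ruleOfKind k M dm2 Loc.triv (.v18 n n') (fun _ => φ) (fun _ => A1) o = vertex18 M.C M.g M.B A1 M.At φ n n' M.S :=
  rule18_diag _ _ _ _ _ _ _ _ _

/-- … kind (1.9). [cite: Balaban1983Higgs3, (1.9) p.413] -/
theorem ruleOfKind_v19_diag (M : Model P N k) (dm2 : HiggsLattice.Site P 0 → ℝ) (n nb : ℕ) (φ : HiggsLattice.ScalarField P 0 N)
    (A1 : HiggsLattice.VecField P 0) (o : Fin 0 → HiggsLattice.ScalarField P k N) :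
    ruleOfKind k M dm2 Loc.triv (.v19 n nb) (fun _ => φ) (fun _ => A1) o = vertex19 M.C M.g M.B A1 M.At φ nb n M.S :=
  rule19_diag _ _ _ _ _ _ _ _ _

/-- … kind (1.10). [cite: Balaban1983Higgs3, (1.10) p.413] -/
theorem ruleOfKind_v110_diag (M : Model P N k) (dm2 : HiggsLattice.Site P 0 → ℝ) (n n' : ℕ) (φ : HiggsLattice.ScalarField P 0 N)
    (A1 : HiggsLattice.VecField P 0) (o : Fin 0 → HiggsLattice.ScalarField P k N) :
    ruleOfKind k M dm2 Loc.triv (.v110 n n') (fun _ => φ) (fun _ => A1) o = vertex110 M.C M.g A1 M.At φ n n' M.S :=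
  rule110_diag _ _ _ _ _ _ _ _

/-- … kind (1.11). [cite: Balaban1983Higgs3, (1.11) p.413] -/
theorem ruleOfKind_v111_diag (M : Model P N k) (dm2 : HiggsLattice.Site P 0 → ℝ) (n nb : ℕ) (φ : HiggsLattice.ScalarField P 0 N)
    (A1 : HiggsLattice.VecField P 0) (o : Fin 0 → HiggsLattice.ScalarField P k N) :
    ruleOfKind k M dm2 Loc.triv (.v111 n nb) (fun _ => φ) (fun _ => A1) o = vertex111 M.C M.g A1 M.At φ nb n M.S :=
  rule111_diag _ _ _ _ _ _ _ _

/-- kernel: a sum against the point weight picks the point. [folklore] -/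
private theorem sum_point_weight {M' : Finset (HiggsLattice.Site P k)} {y : HiggsLattice.Site P k} (hy : y ∈ M') (t : HiggsLattice.Site P k → ℝ) :
    ∑ y' ∈ M', (if y' = y then (1 : ℝ) else 0) * t y' = t y := by
  rw [Finset.sum_eq_single_of_mem y hy fun y' _ h => by rw [if_neg h, zero_mul]]
  rw [if_pos rfl, one_mul]

/-- … kind (1.13), localized at a block point `y ∈ T₁^{(k)} ∩ Ω`: the output co-field paired with the typer's `vertex113`
at `y`. [cite: Balaban1983Higgs3, (1.13) p.413] -/
theorem ruleOfKind_v113_point (M : Model P N k) (dm2 : HiggsLattice.Site P 0 → ℝ) {y : HiggsLattice.Site P k} (hy : y ∈ M.Y)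
    (φ' : HiggsLattice.ScalarField P 0 N) (a : Fin 0 → HiggsLattice.VecField P 0) (o : Fin 1 → HiggsLattice.ScalarField P k N) :
    ruleOfKind k M dm2 (Loc.point y) .v113 (fun _ => φ') a o = ⟪o 0 y, vertex113 M.C M.w M.β φ' k y⟫_ℝ := by
  show rule113 M.C M.w M.β k M.Y (fun y' => if y' = y then 1 else 0) (fun _ => φ') o = _
  unfold rule113
  exact sum_point_weight hy _

/-- … kind (1.14) at `y`, on the diagonal. [cite: Balaban1983Higgs3, (1.14) p.413] -/
theorem ruleOfKind_v114_point (M : Model P N k) (dm2 : HiggsLattice.Site P 0 → ℝ) {y : HiggsLattice.Site P k} (hy : y ∈ M.Y) (n n' : ℕ)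
    (φ' : HiggsLattice.ScalarField P 0 N) (A1 : HiggsLattice.VecField P 0) (o : Fin 1 → HiggsLattice.ScalarField P k N) :
    ruleOfKind k M dm2 (Loc.point y) (.v114 n n') (fun _ => φ') (fun _ => A1) o =
      ⟪o 0 y, vertex114 M.C M.w M.β (M.ctr A1) M.τ φ' k n n' y⟫_ℝ := by
  show rule114 M.C M.w M.β M.τ M.ctr k n n' M.Y (fun y' => if y' = y then 1 else 0) (fun _ => φ') (fun _ => A1) o = _
  unfold rule114
  rw [sum_point_weight hy, avg114_diag]

/-- … kind (1.15) at `y`, on the diagonal. [cite: Balaban1983Higgs3, (1.15) p.414] -/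
theorem ruleOfKind_v115_point (M : Model P N k) (dm2 : HiggsLattice.Site P 0 → ℝ) {y : HiggsLattice.Site P k} (hy : y ∈ M.Y) (n nb : ℕ)
    (φ' : HiggsLattice.ScalarField P 0 N) (A1 : HiggsLattice.VecField P 0) (o : Fin 1 → HiggsLattice.ScalarField P k N) :
    ruleOfKind k M dm2 (Loc.point y) (.v115 n nb) (fun _ => φ') (fun _ => A1) o =
      ⟪o 0 y, vertex115 M.C M.w M.β (M.ctr A1) M.τ φ' k nb n y⟫_ℝ := by
  show rule115 M.C M.w M.β M.τ M.ctr k nb n M.Y (fun y' => if y' = y then 1 else 0) (fun _ => φ') (fun _ => A1) o = _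
  unfold rule115
  rw [sum_point_weight hy, avg115_diag]

variable {nbar : ℕ}

/-- **The Feynman rules of a graph**: vertex `i` of p18's graph `G` gets the rule of its kind `G.kind i` with its own
counterterm label and localization. [cite: Balaban1983Higgs3, p.420] -/
def rulesOf (G : Graph nbar) (M : Model P N k) (dm2 : Fin G.nV → HiggsLattice.Site P 0 → ℝ) (loc : Fin G.nV → Loc P k) :
    Rules G (HiggsLattice.ScalarField P 0 N) (HiggsLattice.VecField P 0) (HiggsLattice.ScalarField P k N) :=
  fun i => ruleOfKind k M (dm2 i) (loc i) (G.kind i)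

/-- The COORDINATE BASIS of `W`-valued lattice fields (`W = ℝ^N`): `δ_x ⊗ e_a`. [cite: Balaban1983Higgs3, p.414] -/
def basisE {j : ℕ} (p : HiggsLattice.Site P j × Fin N) : HiggsLattice.ScalarField P j N := Pi.single p.1 (EuclideanSpace.single p.2 1)

/-- The components of the basis fields: `(δ_x ⊗ e_a)(x′)_{a′} = [x′ = x][a′ = a]`. [cite: Balaban1983Higgs3, p.414] -/
theorem basisE_apply {j : ℕ} (p : HiggsLattice.Site P j × Fin N) (x : HiggsLattice.Site P j) (a : Fin N) :
    basisE p x a = if x = p.1 ∧ a = p.2 then 1 else 0 := by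
  by_cases h1 : x = p.1
  · subst h1
    by_cases h2 : a = p.2
    · subst h2; simp [basisE]
    · simp [basisE, h2]
  · simp [basisE, h1]

/-- The scalar products of the basis fields at a site: `(δ_p(x))·(δ_q(x)) = [x = p.1][x = q.1][p.2 = q.2]` — the Kronecker
deltas through which a polarized rule evaluated on basis fields contracts the indices of its legs. [cite: Balaban1983Higgs3, p.414] -/
theorem inner_basisE {j : ℕ} (p q : HiggsLattice.Site P j × Fin N) (x : HiggsLattice.Site P j) :
    ⟪basisE p x, basisE q x⟫_ℝ = if x = p.1 ∧ x = q.1 ∧ p.2 = q.2 then 1 else 0 := by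
  obtain ⟨x₁, a⟩ := p
  obtain ⟨x₂, b⟩ := q
  rw [PiLp.inner_apply]
  simp only [basisE_apply, RCLike.inner_apply, conj_trivial]
  by_cases h₁ : x = x₁
  · subst h₁
    by_cases h₂ : x = x₂
    · subst h₂
      simp [eq_comm]
    · simp [h₂]
  · simp [h₁]

/-- **Every field is the sum of its components times the basis fields** `φ = Σ_{(x,a)} φ(x)_a · (δ_x ⊗ e_a)` — the expansion behind
the index form of the evaluator (a multilinear vertex rule evaluated on fields = the sum over index assignments of its values on
basis fields times the components). [cite: Balaban1983Higgs3, p.414] -/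
theorem sum_coord_smul_basisE {j : ℕ} (φ : HiggsLattice.ScalarField P j N) :
    ∑ p : HiggsLattice.Site P j × Fin N, φ p.1 p.2 • basisE p = φ := by
  funext x
  rw [Finset.sum_apply, Fintype.sum_prod_type]
  simp only [basisE]
  rw [Finset.sum_eq_single x (fun y _ hy => by simp [Ne.symm hy]) (fun h => (h (Finset.mem_univ x)).elim)]
  simp only [Pi.smul_apply, Pi.single_eq_same]
  ext a
  simp [Pi.single_apply]

/-- The COORDINATE ENTRIES of an operator on scalar fields — how the tree's propagators (`HiggsCovariance.propagatorK`,
(2.22) `propagatorRescaled`, their (2.6) pieces) enter the evaluator as line kernels: `K (x,a) (x′,b) = (G(δ_{x′} ⊗ e_b))(x)_a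
= e_a·G(x,x′)e_b`. [cite: Balaban1982Higgs1, (2.24) p.610] -/
def opEntry {j : ℕ} (Gop : Module.End ℝ (HiggsLattice.ScalarField P j N)) (p q : HiggsLattice.Site P j × Fin N) : ℝ := Gop (basisE q) p.1 p.2

/-- `opEntry` is the entry of the tree's matrix element `HiggsCovariance.kernel G x x′`. [cite: Balaban1982Higgs1, (2.24) p.610] -/
theorem opEntry_eq_kernel {j : ℕ} (Gop : Module.End ℝ (HiggsLattice.ScalarField P j N)) (p q : HiggsLattice.Site P j × Fin N) :
    opEntry Gop p q = kernel Gop p.1 q.1 (EuclideanSpace.single q.2 1) p.2 := rfl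

/-- The entries of an operator on VECTOR fields viewed as `ℝ^d`-valued site fields (the tree's vector propagator
`HiggsFluctMeasure.vecG P m² a j : Module.End ℝ (ScalarField P 0 P.d)`, bond `b` ↔ (site `b₋`, direction of `b`), cf.
`B3MultiscaleFields.toSite`) as a vector-line kernel on bonds. [cite: Balaban1982Higgs1, (2.24) p.610] -/
def bondEntry (Gv : Module.End ℝ (HiggsLattice.ScalarField P 0 P.d)) (b b' : HiggsLattice.PBond P 0) : ℝ :=
  opEntry Gv (b.src, b.dir) (b'.src, b'.dir)

/-- Unfolding of `bondEntry`. [cite: Balaban1982Higgs1, (2.24) p.610] -/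
theorem bondEntry_eq (Gv : Module.End ℝ (HiggsLattice.ScalarField P 0 P.d)) (b b' : HiggsLattice.PBond P 0) :
    bondEntry Gv b b' = Gv (basisE (b'.src, b'.dir)) b.src b.dir := rfl

/-- PRODUCT external scalar fields on the torus carrier (one `W`-valued field per external φ′-leg) as the joint component
function FILE 1's evaluator takes (p. 419: general external fields are *"functions of many variables instead of a
product"*). [cite: Balaban1983Higgs3, p.419] -/
def extS (G : Graph nbar) (φ : ExtSLeg G → HiggsLattice.ScalarField P 0 N) : (ExtSLeg G → HiggsLattice.Site P 0 × Fin N) → ℝ :=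
  fun γ => ∏ ℓ : ExtSLeg G, φ ℓ (γ ℓ).1 (γ ℓ).2

/-- The UNPAIRED outputs of the averaging vertices multiplied with the external field (1.12) `φ(y)` ((1.18): *"a product
of (1.12) and (1.14) or (1.15)"*, coefficient `−κ`, `κ = a_k` with the unit-lattice factor of (1.4)): the joint component
function `ο ↦ Π_ℓ (−κ)·φ(y_ℓ)_{a_ℓ}`. [cite: Balaban1983Higgs3, (1.18) p.415] -/
def extO (G : Graph nbar) (Po : OutPairing G) (κ : ℝ) (φ : HiggsLattice.ScalarField P k N) :
    (Po.Ext → HiggsLattice.Site P k × Fin N) → ℝ :=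
  fun γ => ∏ ℓ : Po.Ext, -κ * φ (γ ℓ).1 (γ ℓ).2

/-- The (1.18) PAIRING KERNEL of two averaging outputs: *"taking a scalar product of two expressions from (1.12)–(1.15)
and multiplying it by −a_k, or −½a_k if they are equal"* — at the same block point: `−κ·[y = y′]·δ_{ab}` (`κ = a_k`, resp.
`½a_k`, with the unit-lattice factor). [cite: Balaban1983Higgs3, (1.18) p.415] -/
def pairKernel (κ : ℝ) (p q : HiggsLattice.Site P k × Fin N) : ℝ := if p = q then -κ else 0

/-- kernel: the scalar product of `W = ℝ^N` in the coordinates the evaluator uses. [folklore] -/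
private theorem inner_eq_sum_coord (x y : E N) : ⟪x, y⟫_ℝ = ∑ a, x a * y a := by
  rw [PiLp.inner_apply]
  simp [mul_comm]

/-- **`pairKernel` realizes (1.18)**: contracting the component families of two output fields against `pairKernel κ` gives
`−κ Σ_y T(y)·T′(y)` — *"a scalar product of two expressions … multiplying it by −a_k"*, both at the same block point.
[cite: Balaban1983Higgs3, (1.18) p.415] -/
theorem sum_pairKernel (κ : ℝ) (U V : HiggsLattice.ScalarField P k N) :
    ∑ p : HiggsLattice.Site P k × Fin N, ∑ q : HiggsLattice.Site P k × Fin N, pairKernel κ p q * U p.1 p.2 * V q.1 q.2 =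
      -κ * ∑ y, ⟪U y, V y⟫_ℝ := by
  have h1 : ∀ p : HiggsLattice.Site P k × Fin N,
      ∑ q : HiggsLattice.Site P k × Fin N, pairKernel κ p q * U p.1 p.2 * V q.1 q.2 = -κ * (U p.1 p.2 * V p.1 p.2) := by
    intro p
    rw [Finset.sum_eq_single p (fun q _ hq => by rw [pairKernel, if_neg (Ne.symm hq), zero_mul, zero_mul])
      (fun h => (h (Finset.mem_univ p)).elim)]
    rw [pairKernel, if_pos rfl]
    ring
  simp only [h1]
  rw [← Finset.mul_sum, Fintype.sum_prod_type]
  congr 1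
  refine Finset.sum_congr rfl fun y _ => ?_
  rw [inner_eq_sum_coord]

variable [DecidableEq (HiggsLattice.PBond P 0)]

/-- **E(G, {□(v)}, Φ_ext, A_ext) for p18's graphs with the catalogue's rules** (p. 420): FILE 1's evaluator `amp` at the
rules `rulesOf G M dm2 loc`, in the coordinate bases of `T_η × {1..N}` (φ′-legs), bonds (A′-legs) and `T₁^{(k)} × {1..N}`
(outputs of the averaging vertices); the line kernels (entries of `G_k(Ω,B̃)`, of the vector covariance, the (1.18) pairing
`−a_k[y = y′]δ_{ab}`), the (1.18) output pairing and the external fields are supplied. [cite: Balaban1983Higgs3, p.420]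
[cite: Balaban1983Higgs3, (1.18) p.415] -/
def graphAmp (G : Graph nbar) (M : Model P N k) (dm2 : Fin G.nV → HiggsLattice.Site P 0 → ℝ) (loc : Fin G.nV → Loc P k)
    (Po : OutPairing G) (Ks : SLine G → HiggsLattice.Site P 0 × Fin N → HiggsLattice.Site P 0 × Fin N → ℝ)
    (Kv : VLine G → HiggsLattice.PBond P 0 → HiggsLattice.PBond P 0 → ℝ) (Ko : Po.Line oRank → HiggsLattice.Site P k × Fin N → HiggsLattice.Site P k × Fin N → ℝ)
    (Φ : (ExtSLeg G → HiggsLattice.Site P 0 × Fin N) → ℝ) (A : (ExtVLeg G → HiggsLattice.PBond P 0) → ℝ) (Ψ : (Po.Ext → HiggsLattice.Site P k × Fin N) → ℝ) : ℝ :=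
  amp (rulesOf G M dm2 loc) basisE basisV basisE Po Ks Kv Ko Φ A Ψ

/-- **p. 420 ON THE CONCRETE EVALUATOR — the sum over localizations**: for any finite families of localizations of the
vertices, the sum over all assignments `c : v ↦ □(v)` of the localized expressions is the expression with, at every vertex,
the summed localization. [cite: Balaban1983Higgs3, p.420] -/
theorem graphAmp_loc_sum (G : Graph nbar) (M : Model P N k) (dm2 : Fin G.nV → HiggsLattice.Site P 0 → ℝ)
    {Cx : Fin G.nV → Type*} [∀ i, Fintype (Cx i)] (l : (i : Fin G.nV) → Cx i → Loc P k) (Po : OutPairing G)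
    (Ks : SLine G → HiggsLattice.Site P 0 × Fin N → HiggsLattice.Site P 0 × Fin N → ℝ) (Kv : VLine G → HiggsLattice.PBond P 0 → HiggsLattice.PBond P 0 → ℝ)
    (Ko : Po.Line oRank → HiggsLattice.Site P k × Fin N → HiggsLattice.Site P k × Fin N → ℝ) (Φ : (ExtSLeg G → HiggsLattice.Site P 0 × Fin N) → ℝ)
    (A : (ExtVLeg G → HiggsLattice.PBond P 0) → ℝ) (Ψ : (Po.Ext → HiggsLattice.Site P k × Fin N) → ℝ) :
    ∑ c : (i : Fin G.nV) → Cx i, graphAmp G M dm2 (fun i => l i (c i)) Po Ks Kv Ko Φ A Ψ =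
      graphAmp G M dm2 (fun i => Loc.sum (l i)) Po Ks Kv Ko Φ A Ψ := by
  unfold graphAmp rulesOf
  have h := (amp_rules_sum (G := G) (fun i c' => ruleOfKind k M (dm2 i) (l i c') (G.kind i))
    basisE basisV basisE Po Ks Kv Ko Φ A Ψ).symm
  beta_reduce at h
  rw [h]
  congr 1
  funext i f a o
  exact ruleOfKind_sum M (dm2 i) (l i) (G.kind i) f a o

/-- **E(G) = Σ_{localizations} E(G, {□(v)})** (p. 420: *"with each expression there is connected some localization"*): when
every vertex's family of localizations is a partition (unit cubes covering `T_η`; the smooth partition of unity; the points of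
`T₁^{(k)} ∩ Ω`), the localized expressions sum to the unlocalized one. [cite: Balaban1983Higgs3, p.420] -/
theorem graphAmp_partition_sum (G : Graph nbar) (M : Model P N k) (dm2 : Fin G.nV → HiggsLattice.Site P 0 → ℝ)
    {Cx : Fin G.nV → Type*} [∀ i, Fintype (Cx i)] (l : (i : Fin G.nV) → Cx i → Loc P k)
    (hl : ∀ i, Loc.IsPartitionFor (G.kind i) (l i)) (Po : OutPairing G)
    (Ks : SLine G → HiggsLattice.Site P 0 × Fin N → HiggsLattice.Site P 0 × Fin N → ℝ) (Kv : VLine G → HiggsLattice.PBond P 0 → HiggsLattice.PBond P 0 → ℝ)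
    (Ko : Po.Line oRank → HiggsLattice.Site P k × Fin N → HiggsLattice.Site P k × Fin N → ℝ) (Φ : (ExtSLeg G → HiggsLattice.Site P 0 × Fin N) → ℝ)
    (A : (ExtVLeg G → HiggsLattice.PBond P 0) → ℝ) (Ψ : (Po.Ext → HiggsLattice.Site P k × Fin N) → ℝ) :
    ∑ c : (i : Fin G.nV) → Cx i, graphAmp G M dm2 (fun i => l i (c i)) Po Ks Kv Ko Φ A Ψ =
      graphAmp G M dm2 (fun _ => Loc.triv) Po Ks Kv Ko Φ A Ψ := by
  rw [graphAmp_loc_sum]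
  unfold graphAmp rulesOf
  congr 1
  funext i f a o
  exact ruleOfKind_congr M (dm2 i) (G.kind i) (hl i) f a o

/-- **(2.7) p. 425 for the concrete evaluator**: decomposing the scalar propagator of every line into pieces ((2.6)) writes
E(G′) as the sum over the assignments of pieces to lines. [cite: Balaban1983Higgs3, (2.7) p.425] -/
theorem graphAmp_sLines_sum {T : Type*} [Fintype T] (G : Graph nbar) (M : Model P N k) (dm2 : Fin G.nV → HiggsLattice.Site P 0 → ℝ)
    (loc : Fin G.nV → Loc P k) (Po : OutPairing G) (K : SLine G → T → HiggsLattice.Site P 0 × Fin N → HiggsLattice.Site P 0 × Fin N → ℝ)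
    (Kv : VLine G → HiggsLattice.PBond P 0 → HiggsLattice.PBond P 0 → ℝ) (Ko : Po.Line oRank → HiggsLattice.Site P k × Fin N → HiggsLattice.Site P k × Fin N → ℝ)
    (Φ : (ExtSLeg G → HiggsLattice.Site P 0 × Fin N) → ℝ) (A : (ExtVLeg G → HiggsLattice.PBond P 0) → ℝ) (Ψ : (Po.Ext → HiggsLattice.Site P k × Fin N) → ℝ) :
    graphAmp G M dm2 loc Po (fun l p q => ∑ t, K l t p q) Kv Ko Φ A Ψ =
      ∑ j : SLine G → T, graphAmp G M dm2 loc Po (fun l => K l (j l)) Kv Ko Φ A Ψ :=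
  amp_sLines_sum _ _ _ _ _ _ _ _ _ _ _

/-- (2.7) for the concrete evaluator, vector lines (*"and the similar equality for the vector field propagator"*).
[cite: Balaban1983Higgs3, (2.7) p.425] -/
theorem graphAmp_vLines_sum {T : Type*} [Fintype T] (G : Graph nbar) (M : Model P N k) (dm2 : Fin G.nV → HiggsLattice.Site P 0 → ℝ)
    (loc : Fin G.nV → Loc P k) (Po : OutPairing G) (Ks : SLine G → HiggsLattice.Site P 0 × Fin N → HiggsLattice.Site P 0 × Fin N → ℝ)
    (K : VLine G → T → HiggsLattice.PBond P 0 → HiggsLattice.PBond P 0 → ℝ)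
    (Ko : Po.Line oRank → HiggsLattice.Site P k × Fin N → HiggsLattice.Site P k × Fin N → ℝ)
    (Φ : (ExtSLeg G → HiggsLattice.Site P 0 × Fin N) → ℝ) (A : (ExtVLeg G → HiggsLattice.PBond P 0) → ℝ)
    (Ψ : (Po.Ext → HiggsLattice.Site P k × Fin N) → ℝ) :
    graphAmp G M dm2 loc Po Ks (fun l p q => ∑ t, K l t p q) Ko Φ A Ψ =
      ∑ j : VLine G → T, graphAmp G M dm2 loc Po Ks (fun l => K l (j l)) Ko Φ A Ψ :=
  amp_vLines_sum _ _ _ _ _ _ _ _ _ _ _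

end Assembly

end

end Literature.MathematicalPhysics.QuantumFieldTheory.Balaban1983to89.B3GraphAmplitudeRules
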